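import Mathlib.Tactic.Ring
import Mathlib.Tactic.Linarith
import Mathlib.Tactic.Positivity
import Mathlib.Tactic.LinearCombination
import Mathlib.Tactic.FieldSimp
import Mathlib.Data.Real.Basic
import Mathlib.Analysis.SpecialFunctions.Complex.Arg
import Mathlib.Analysis.SpecialFunctions.Trigonometric.Basic
import HarnessLib

/-!
# THE THREE-PHASE IDENTITY: complex-charge class-test quantities as averages of three real projections (hodge-weil ladder, GAPS G51c)

Prover 2, generation 14 (note `run/shared/lean/b2b/hodge-weil/b2b-hweil-pv2-g14/THREE-PHASE-G14.md`). Setting: the charge-0 class-test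
quantities of a corank-one determinantal design with COMPLEX charges `C_k = u_k + i·x_k` (dictionary (G) of
`Literature/…/WeilClassTestChargeZeroLemma.lean`; `CHARGE-ZERO-LEMMA.md` §1): `Q₂(A;C) = ½S_A·Σε|C|² + |ΣεAC|² − 3ΣεA²|C|²`,
`Q₄(C) = 3Σε|C|⁴ − (Σε|C|²)² − ½|ΣεC²|²`, written through the signed moments `SA = ΣεA²`, `MU = Σεu²`, `MX = Σεx²`, `MUX = Σεux`,
`SAu = ΣεAu`, `SAx = ΣεAx`, `Tuu = ΣεA²u²`, `Tux = ΣεA²ux`, `Txx = ΣεA²x²`, `Fab = Σεu^a x^b` (`a + b = 4`). For a direction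
`(c, s)` the REAL PROJECTION `w = c·u − s·x = Re(e^{iθ}C)` has `Q₂(A;w) = q₂(c,s)`, `Q₄(w) = q₄(c,s)` (quadratic / quartic forms in
`(c,s)` with these moments as coefficients). THEOREM (`three_phase_moment_identity`, pure algebra): with `r² = 3` and the three
directions `(c,s)`, `((−c − rs)/2, (rc − s)/2)`, `((−c + rs)/2, (−rc − s)/2)` (rotations by `0, 2π/3, 4π/3`),
`(c²+s²)·Q₂(A;C) + μ(c²+s²)²·Q₄(C) = (2/3)·Σ_j [q₂(c_j,s_j) + (4μ/3)·q₄(c_j,s_j)]` for every `μ` — the circle averages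
`Q₂(A;C) = 2·avg_θ Q₂(A;Re e^{iθ}C)`, `Q₄(C) = (8/3)·avg_θ Q₄(Re e^{iθ}C)` are reproduced by any three equally spaced directions
(a quartic form on the circle has frequencies `0, 2, 4`, none divisible by `3`). Consequently (`three_phase_combine`) the complex
inequality `Q₂(A;C) + μQ₄(C) ≥ 0` follows from the three REAL inequalities `Q₂(A;w_j) + (4μ/3)Q₄(w_j) ≥ 0`. The cubic purity
condition (P4) `ΣεC|C|² = 0` makes `Σεw³ = a·cos3θ + b·sin3θ` (`a = Σεu³`, `b = Σεx³`), the SAME for the three directions, so one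
choice of `θ` (`angle_exists`) makes all three projections real-pure; `proj_amp` transfers pairwise ampleness. Format-free; used in
format (4,2) by `WeilClassTestFormatFourTwoComplex.lean`. Nothing here is a case of HC, a rung or a door edge (C22); no statement of
Markman's papers is used. New cell result ⇒ Summits/.
-/

set_option linter.dupNamespace false

namespace Summit.HodgeConjecture.HodgeConjecture.WeilClassTestThreePhase

/-- ANGLE CHOICE: for all real `a, b` there is a unit vector `(c, s) = (cos θ, sin θ)` with `a·cos 3θ + b·sin 3θ = 0`
(written polynomially: `cos 3θ = c³ − 3cs²`, `sin 3θ = 3c²s − s³` on the unit circle). Take `3θ = arg(−b + ia)`. -/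
theorem angle_exists (a b : ℝ) :
    ∃ c s : ℝ, c ^ 2 + s ^ 2 = 1 ∧ a * (c ^ 3 - 3 * c * s ^ 2) + b * (3 * c ^ 2 * s - s ^ 3) = 0 := by
  by_cases hz : (⟨-b, a⟩ : ℂ) = 0
  · have hb : b = 0 := by have h := congrArg Complex.re hz; simp at h; linarith
    have ha : a = 0 := by have h := congrArg Complex.im hz; simpa using h
    exact ⟨1, 0, by norm_num, by rw [ha, hb]; ring⟩
  · refine ⟨Real.cos (Complex.arg (⟨-b, a⟩ : ℂ) / 3), Real.sin (Complex.arg (⟨-b, a⟩ : ℂ) / 3), Real.cos_sq_add_sin_sq _, ?_⟩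
    set θ : ℝ := Complex.arg (⟨-b, a⟩ : ℂ) / 3 with hθ
    have h3 : Complex.arg (⟨-b, a⟩ : ℂ) = 3 * θ := by rw [hθ]; ring
    have hc : Real.cos (3 * θ) = -b / ‖(⟨-b, a⟩ : ℂ)‖ := by rw [← h3, Complex.cos_arg hz]
    have hs : Real.sin (3 * θ) = a / ‖(⟨-b, a⟩ : ℂ)‖ := by rw [← h3, Complex.sin_arg]
    have pyth := Real.cos_sq_add_sin_sq θ
    have e1 : Real.cos θ ^ 3 - 3 * Real.cos θ * Real.sin θ ^ 2 = Real.cos (3 * θ) := by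
      rw [Real.cos_three_mul]; linear_combination (-3 * Real.cos θ) * pyth
    have e2 : 3 * Real.cos θ ^ 2 * Real.sin θ - Real.sin θ ^ 3 = Real.sin (3 * θ) := by
      rw [Real.sin_three_mul]; linear_combination (3 * Real.sin θ) * pyth
    rw [e1, e2, hc, hs]
    ring

/-- AMPLENESS TRANSFER: `|Re(e^{iθ}(C_e − D_f))| ≤ |C_e − D_f| ≤ A_e − B_f` — for a unit direction `(c,s)`,
`|(cu − sx) − (cv − sy)| ≤ a` whenever `√((u−v)² + (x−y)²) ≤ a`. -/
theorem proj_amp (c s u x v y a : ℝ) (hcs : c ^ 2 + s ^ 2 = 1)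
    (h : Real.sqrt ((u - v) ^ 2 + (x - y) ^ 2) ≤ a) :
    |(c * u - s * x) - (c * v - s * y)| ≤ a := by
  refine le_trans (Real.abs_le_sqrt ?_) h
  have e : ((c * u - s * x) - (c * v - s * y)) ^ 2
      = ((u - v) ^ 2 + (x - y) ^ 2) - (c * (x - y) + s * (u - v)) ^ 2 := by
    linear_combination ((u - v) ^ 2 + (x - y) ^ 2) * hcs
  nlinarith [e, sq_nonneg (c * (x - y) + s * (u - v))]

/-- The direction rotated by `2π/3` is a unit vector (`r² = 3`). -/
theorem dir_norm₁ (c s r : ℝ) (hr : r ^ 2 = 3) (hcs : c ^ 2 + s ^ 2 = 1) :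
    ((-c - r * s) / 2) ^ 2 + ((r * c - s) / 2) ^ 2 = 1 := by
  linear_combination hcs + ((c ^ 2 + s ^ 2) / 4) * hr

/-- The direction rotated by `4π/3` is a unit vector (`r² = 3`). -/
theorem dir_norm₂ (c s r : ℝ) (hr : r ^ 2 = 3) (hcs : c ^ 2 + s ^ 2 = 1) :
    ((-c + r * s) / 2) ^ 2 + ((-r * c - s) / 2) ^ 2 = 1 := by
  linear_combination hcs + ((c ^ 2 + s ^ 2) / 4) * hr

/-- Rotation by `2π/3` preserves `cos 3θ`: `c₁³ − 3c₁s₁² = c³ − 3cs²` (`r² = 3`). -/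
theorem dir_cub₁ (c s r : ℝ) (hr : r ^ 2 = 3) :
    ((-c - r * s) / 2) ^ 3 - 3 * ((-c - r * s) / 2) * ((r * c - s) / 2) ^ 2 = c ^ 3 - 3 * c * s ^ 2 := by
  linear_combination ((-9/8 : ℝ) * c * s ^ 2 + (3/8 : ℝ) * c ^ 3 + (-1/8 : ℝ) * s ^ 3 * r + (3/8 : ℝ) * c ^ 2 * s * r) * hr

/-- Rotation by `2π/3` preserves `sin 3θ`: `3c₁²s₁ − s₁³ = 3c²s − s³` (`r² = 3`). -/
theorem dir_cub₁' (c s r : ℝ) (hr : r ^ 2 = 3) :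
    3 * ((-c - r * s) / 2) ^ 2 * ((r * c - s) / 2) - ((r * c - s) / 2) ^ 3 = 3 * c ^ 2 * s - s ^ 3 := by
  linear_combination ((-3/8 : ℝ) * s ^ 3 + (9/8 : ℝ) * c ^ 2 * s + (3/8 : ℝ) * c * s ^ 2 * r + (-1/8 : ℝ) * c ^ 3 * r) * hr

/-- Rotation by `4π/3` preserves `cos 3θ` (`r² = 3`). -/
theorem dir_cub₂ (c s r : ℝ) (hr : r ^ 2 = 3) :
    ((-c + r * s) / 2) ^ 3 - 3 * ((-c + r * s) / 2) * ((-r * c - s) / 2) ^ 2 = c ^ 3 - 3 * c * s ^ 2 := by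
  linear_combination ((-9/8 : ℝ) * c * s ^ 2 + (3/8 : ℝ) * c ^ 3 + (1/8 : ℝ) * s ^ 3 * r + (-3/8 : ℝ) * c ^ 2 * s * r) * hr

/-- Rotation by `4π/3` preserves `sin 3θ` (`r² = 3`). -/
theorem dir_cub₂' (c s r : ℝ) (hr : r ^ 2 = 3) :
    3 * ((-c + r * s) / 2) ^ 2 * ((-r * c - s) / 2) - ((-r * c - s) / 2) ^ 3 = 3 * c ^ 2 * s - s ^ 3 := by
  linear_combination ((-3/8 : ℝ) * s ^ 3 + (9/8 : ℝ) * c ^ 2 * s + (-3/8 : ℝ) * c * s ^ 2 * r + (1/8 : ℝ) * c ^ 3 * r) * hr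

/-- **THE THREE-PHASE IDENTITY** (moment level, format-free; `r² = 3`, ANY direction `(c, s)`, any `μ`):
`(c²+s²)·Q₂(A;C) + μ(c²+s²)²·Q₄(C) = (2/3)·Σ_{j=0,1,2} [q₂(c_j,s_j) + (4μ/3)·q₄(c_j,s_j)]`, where `q₂(c,s)`, `q₄(c,s)` are
`Q₂(A; cu − sx)`, `Q₄(cu − sx)` written in the signed moments and `(c_j, s_j)` are `(c,s)` rotated by `2πj/3`. -/
theorem three_phase_moment_identity (SA MU MX MUX SAu SAx Tuu Tux Txx F40 F31 F22 F13 F04 c s r μ : ℝ) (hr : r ^ 2 = 3) :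
    (c ^ 2 + s ^ 2) * ((1 / 2) * SA * (MU + MX) + (SAu ^ 2 + SAx ^ 2) - 3 * (Tuu + Txx))
      + μ * (c ^ 2 + s ^ 2) ^ 2 * (3 * (F40 + 2 * F22 + F04) - (MU + MX) ^ 2 - (1 / 2) * ((MU - MX) ^ 2 + 4 * MUX ^ 2))
      = (2 / 3) * (((1 / 2) * SA * (c ^ 2 * MU - 2 * c * s * MUX + s ^ 2 * MX) + (c * SAu - s * SAx) ^ 2 - 3 * (c ^ 2 * Tuu - 2 * c * s * Tux + s ^ 2 * Txx)
        + 4 * μ / 3 * (3 * (c ^ 4 * F40 - 4 * c ^ 3 * s * F31 + 6 * c ^ 2 * s ^ 2 * F22 - 4 * c * s ^ 3 * F13 + s ^ 4 * F04) - (3 / 2) * (c ^ 2 * MU - 2 * c * s * MUX + s ^ 2 * MX) ^ 2))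
        + ((1 / 2) * SA * (((-c - r * s) / 2) ^ 2 * MU - 2 * ((-c - r * s) / 2) * ((r * c - s) / 2) * MUX + ((r * c - s) / 2) ^ 2 * MX) + (((-c - r * s) / 2) * SAu - ((r * c - s) / 2) * SAx) ^ 2 - 3 * (((-c - r * s) / 2) ^ 2 * Tuu - 2 * ((-c - r * s) / 2) * ((r * c - s) / 2) * Tux + ((r * c - s) / 2) ^ 2 * Txx)
        + 4 * μ / 3 * (3 * (((-c - r * s) / 2) ^ 4 * F40 - 4 * ((-c - r * s) / 2) ^ 3 * ((r * c - s) / 2) * F31 + 6 * ((-c - r * s) / 2) ^ 2 * ((r * c - s) / 2) ^ 2 * F22 - 4 * ((-c - r * s) / 2) * ((r * c - s) / 2) ^ 3 * F13 + ((r * c - s) / 2) ^ 4 * F04) - (3 / 2) * (((-c - r * s) / 2) ^ 2 * MU - 2 * ((-c - r * s) / 2) * ((r * c - s) / 2) * MUX + ((r * c - s) / 2) ^ 2 * MX) ^ 2))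
        + ((1 / 2) * SA * (((-c + r * s) / 2) ^ 2 * MU - 2 * ((-c + r * s) / 2) * ((-r * c - s) / 2) * MUX + ((-r * c - s) / 2) ^ 2 * MX) + (((-c + r * s) / 2) * SAu - ((-r * c - s) / 2) * SAx) ^ 2 - 3 * (((-c + r * s) / 2) ^ 2 * Tuu - 2 * ((-c + r * s) / 2) * ((-r * c - s) / 2) * Tux + ((-r * c - s) / 2) ^ 2 * Txx)
        + 4 * μ / 3 * (3 * (((-c + r * s) / 2) ^ 4 * F40 - 4 * ((-c + r * s) / 2) ^ 3 * ((-r * c - s) / 2) * F31 + 6 * ((-c + r * s) / 2) ^ 2 * ((-r * c - s) / 2) ^ 2 * F22 - 4 * ((-c + r * s) / 2) * ((-r * c - s) / 2) ^ 3 * F13 + ((-r * c - s) / 2) ^ 4 * F04) - (3 / 2) * (((-c + r * s) / 2) ^ 2 * MU - 2 * ((-c + r * s) / 2) * ((-r * c - s) / 2) * MUX + ((-r * c - s) / 2) ^ 2 * MX) ^ 2))) := by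
  linear_combination ((1 : ℝ) * Txx * c ^ 2 + (2 : ℝ) * Tux * c * s + (1 : ℝ) * Tuu * s ^ 2 + (-1/3 : ℝ) * SAx ^ 2 * c ^ 2 + (-2/3 : ℝ) * SAu * SAx * c * s + (-1/3 : ℝ) * SAu ^ 2 * s ^ 2 + (-1/3 : ℝ) * SA * MUX * c * s + (-1/6 : ℝ) * SA * MX * c ^ 2 + (-1/6 : ℝ) * SA * MU * s ^ 2 + (-2 : ℝ) * F04 * c ^ 2 * s ^ 2 * μ + (-1 : ℝ) * F04 * c ^ 4 * μ + (-4 : ℝ) * F13 * c * s ^ 3 * μ + (-2 : ℝ) * F22 * s ^ 4 * μ + (2 : ℝ) * F22 * c ^ 2 * s ^ 2 * μ + (-2 : ℝ) * F22 * c ^ 4 * μ + (-4 : ℝ) * F31 * c ^ 3 * s * μ + (-1 : ℝ) * F40 * s ^ 4 * μ + (-2 : ℝ) * F40 * c ^ 2 * s ^ 2 * μ + (2/3 : ℝ) * MUX ^ 2 * s ^ 4 * μ + (-2/3 : ℝ) * MUX ^ 2 * c ^ 2 * s ^ 2 * μ + (2/3 : ℝ) * MUX ^ 2 * c ^ 4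 * μ + (2 : ℝ) * MX * MUX * c * s ^ 3 * μ + (1 : ℝ) * MX ^ 2 * c ^ 2 * s ^ 2 * μ + (1/2 : ℝ) * MX ^ 2 * c ^ 4 * μ + (2 : ℝ) * MU * MUX * c ^ 3 * s * μ + (1/3 : ℝ) * MU * MX * s ^ 4 * μ + (-1/3 : ℝ) * MU * MX * c ^ 2 * s ^ 2 * μ + (1/3 : ℝ) * MU * MX * c ^ 4 * μ + (1/2 : ℝ) * MU ^ 2 * s ^ 4 * μ + (1 : ℝ) * MU ^ 2 * c ^ 2 * s ^ 2 * μ + (-1/3 : ℝ) * F04 * c ^ 4 * r ^ 2 * μ + (-4/3 : ℝ) * F13 * c ^ 3 * s * r ^ 2 * μ + (-2 : ℝ) * F22 * c ^ 2 * s ^ 2 * r ^ 2 * μ + (-4/3 : ℝ) * F31 * c * s ^ 3 * r ^ 2 * μ + (-1/3 : ℝ) * F40 * s ^ 4 * r ^ 2 * μ + (2/3 : ℝ) * MUX ^ 2 * c ^ 2 * s ^ 2 * r ^ 2 * μ + (2/3 : ℝ) * MX * MUX * c ^ 3 * s * r ^ 2 * μ + (1/6 : ℝ) * MX ^ 2 *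 c ^ 4 * r ^ 2 * μ + (2/3 : ℝ) * MU * MUX * c * s ^ 3 * r ^ 2 * μ + (1/3 : ℝ) * MU * MX * c ^ 2 * s ^ 2 * r ^ 2 * μ + (1/6 : ℝ) * MU ^ 2 * s ^ 4 * r ^ 2 * μ) * hr

/-- **THREE-PHASE REDUCTION** (moment level): for a unit direction `(c,s)` and `r² = 3`, the three real inequalities
`q₂(c_j,s_j) + (4μ/3)·q₄(c_j,s_j) ≥ 0` imply the complex one `Q₂(A;C) + μ·Q₄(C) ≥ 0`. -/
theorem three_phase_combine (SA MU MX MUX SAu SAx Tuu Tux Txx F40 F31 F22 F13 F04 c s r μ : ℝ) (hr : r ^ 2 = 3) (hcs : c ^ 2 + s ^ 2 = 1)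
    (h₀ : 0 ≤ ((1 / 2) * SA * (c ^ 2 * MU - 2 * c * s * MUX + s ^ 2 * MX) + (c * SAu - s * SAx) ^ 2 - 3 * (c ^ 2 * Tuu - 2 * c * s * Tux + s ^ 2 * Txx)
        + 4 * μ / 3 * (3 * (c ^ 4 * F40 - 4 * c ^ 3 * s * F31 + 6 * c ^ 2 * s ^ 2 * F22 - 4 * c * s ^ 3 * F13 + s ^ 4 * F04) - (3 / 2) * (c ^ 2 * MU - 2 * c * s * MUX + s ^ 2 * MX) ^ 2)))
    (h₁ : 0 ≤ ((1 / 2) * SA * (((-c - r * s) / 2) ^ 2 * MU - 2 * ((-c - r * s) / 2) * ((r * c - s) / 2) * MUX + ((r * c - s) / 2) ^ 2 * MX) + (((-c - r * s) / 2) * SAu - ((r * c - s) / 2) * SAx) ^ 2 - 3 * (((-c - r * s) / 2) ^ 2 * Tuu - 2 * ((-c - r * s) / 2) * ((r * c - s) / 2) * Tux + ((r * c - s) / 2) ^ 2 * Txx)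
        + 4 * μ / 3 * (3 * (((-c - r * s) / 2) ^ 4 * F40 - 4 * ((-c - r * s) / 2) ^ 3 * ((r * c - s) / 2) * F31 + 6 * ((-c - r * s) / 2) ^ 2 * ((r * c - s) / 2) ^ 2 * F22 - 4 * ((-c - r * s) / 2) * ((r * c - s) / 2) ^ 3 * F13 + ((r * c - s) / 2) ^ 4 * F04) - (3 / 2) * (((-c - r * s) / 2) ^ 2 * MU - 2 * ((-c - r * s) / 2) * ((r * c - s) / 2) * MUX + ((r * c - s) / 2) ^ 2 * MX) ^ 2)))
    (h₂ : 0 ≤ ((1 / 2) * SA * (((-c + r * s) / 2) ^ 2 * MU - 2 * ((-c + r * s) / 2) * ((-r * c - s) / 2) * MUX + ((-r * c - s) / 2) ^ 2 * MX) + (((-c + r * s) / 2) * SAu - ((-r * c - s) / 2) * SAx) ^ 2 - 3 * (((-c + r * s) / 2) ^ 2 * Tuu - 2 * ((-c + r * s) / 2) * ((-r * c - s) / 2) * Tux + ((-r * c - s) / 2) ^ 2 * Txx)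
        + 4 * μ / 3 * (3 * (((-c + r * s) / 2) ^ 4 * F40 - 4 * ((-c + r * s) / 2) ^ 3 * ((-r * c - s) / 2) * F31 + 6 * ((-c + r * s) / 2) ^ 2 * ((-r * c - s) / 2) ^ 2 * F22 - 4 * ((-c + r * s) / 2) * ((-r * c - s) / 2) ^ 3 * F13 + ((-r * c - s) / 2) ^ 4 * F04) - (3 / 2) * (((-c + r * s) / 2) ^ 2 * MU - 2 * ((-c + r * s) / 2) * ((-r * c - s) / 2) * MUX + ((-r * c - s) / 2) ^ 2 * MX) ^ 2))) :
    0 ≤ ((1 / 2) * SA * (MU + MX) + (SAu ^ 2 + SAx ^ 2) - 3 * (Tuu + Txx))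
      + μ * (3 * (F40 + 2 * F22 + F04) - (MU + MX) ^ 2 - (1 / 2) * ((MU - MX) ^ 2 + 4 * MUX ^ 2)) := by
  have H := three_phase_moment_identity SA MU MX MUX SAu SAx Tuu Tux Txx F40 F31 F22 F13 F04 c s r μ hr
  have e : (c ^ 2 + s ^ 2) * ((1 / 2) * SA * (MU + MX) + (SAu ^ 2 + SAx ^ 2) - 3 * (Tuu + Txx))
      + μ * (c ^ 2 + s ^ 2) ^ 2 * (3 * (F40 + 2 * F22 + F04) - (MU + MX) ^ 2 - (1 / 2) * ((MU - MX) ^ 2 + 4 * MUX ^ 2))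
      = ((1 / 2) * SA * (MU + MX) + (SAu ^ 2 + SAx ^ 2) - 3 * (Tuu + Txx))
      + μ * (3 * (F40 + 2 * F22 + F04) - (MU + MX) ^ 2 - (1 / 2) * ((MU - MX) ^ 2 + 4 * MUX ^ 2)) := by
    rw [hcs]; ring
  rw [← e, H]
  have := add_nonneg (add_nonneg h₀ h₁) h₂
  linarith

end Summit.HodgeConjecture.HodgeConjecture.WeilClassTestThreePhase
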